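import Summits.QuantumFields.YangMills.Statement
import HarnessLib
import HarnessLib.Audit.Tags

/-!
# QuantumFields / YangMills — the non-freezing rung (solo seat `solo-QuantumFields-informed`)

**The node.** `LatticeNonFreezing`: for every compact simple `G` and every faithful unitary lattice
representation `r` (Wilson action `β ∑ₚ Re tr r.ρ(Uₚ)` on periodic tori of side `2S + 1` in `d = 4`), NO rate
`μ > 0` and constant `C` bound the plaquette–plaquette truncated correlations
`|⟨P₀ ; P_{(n, y)}⟩_{β,S}| ≤ C e^{−μ n}` at all large `β` on all large tori: for every `(C, μ)` and every large
`β` there are, on EVERY sufficiently large torus, a time separation `n ≤ S` and a spatial offset `y` beating the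
bound. Informally: the lattice correlation length of `tr F²` (in lattice units) tends to `+∞` as `β → +∞`,
volume-uniformly — the second half of Chatterjee's Problem 5.1 (arXiv:1803.01950, §5, p. 8: "prove that
`lim_{β→∞} ξ(β) = ∞`"), open in print for every non-abelian compact Lie group in `d = 4` (Montvay–Münster 1994,
§3.7.1, pp. 161–164 list no weak-coupling result of this kind). It is NECESSARY for the summit in substance (a
continuum limit with `a_k → 0` and a gap `Δ` in physical units forces lattice correlation lengths `≍ 1/(Δ a_k) →
∞` at `β_k → ∞`), it is GROUP-SENSITIVE only through `dim G ≥ 1` (it holds in the Coulomb phase of `U(1)₄`, so it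
does not separate abelian from non-abelian — it is a rung, not the summit), and it is typed so that the two junk
readings are excluded: (i) `S₀` is chosen AFTER `β` and the witness must exist on every torus `S ≥ S₀` (no
femto-torus `β ≫ S⁴` artefacts, where torons give trivially long-ranged `O(β⁻²)` correlations); (ii) `n = 0`,
`C < 0` are harmless (the conclusion is then trivially true and carries no information; the content is at
`C ≫ 1`, which forces `n → ∞`).

**The criterion** (`latticeNonFreezing_of_rpVariationalWitness`, sorry-free): `RPVariationalWitness →
LatticeNonFreezing`, where the witness packages — per `G, r`, for every `δ > 0`, at all large `β`, with
`β`-dependent floor `v > 0`, constant `K` and width `w`, on every large torus — a real sequence `f` (intended: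
`f(n) = ⟨θF_β · τ_{n e₀} F_β⟩_{β,S}` for a gauge-invariant, bounded, mean-zero, time-smeared block observable
`F_β` built from plaquettes at scale `ℓ = β^ε`, `θ` the time reflection) that is positive and log-convex on the
horizon `n + w ≤ S` (reflection positivity of Wilson's action on the odd torus: transfer matrix `T ≥ 0`,
Osterwalder–Seiler 1978), has first ratio `f(1) ≥ (1 − δ) f(0)` (the one-step variational estimate: the hard
analytic input, `δ = c β^{−ε₀}`), floor `f(0) ≥ v` and is dominated by every antitone envelope of the plaquette-pair
correlations (`K = ‖h‖₁²`, `w = 2ℓ`: `F_β` is a finite combination of translates of `P`). The proof is the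
log-convexity lemma `f(n) ≥ f(0) (f(1)/f(0))ⁿ` (`geom_mul_pow_le_of_logConvex`) against `K C e^{−μ n}` with
`δ := 1 − e^{−μ/2}`.

No facts, no axioms, no `sorry`: pure logic and real analysis over the audited interface
(`latticeConnectedCorr`, `LatticeRep.curvature`, `configShift`).
-/

open MeasureTheory Filter Topology
open Literature.MathematicalPhysics.AQFT Literature.MathematicalPhysics.QuantumLattice
open Literature.MathematicalPhysics.QuantumFieldTheory Literature.Probability.LatticeModels

noncomputable section

namespace Summit.QuantumFields.YangMills.Theorems

/-! ### Log-convex sequences -/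

/-- A positive sequence that is log-convex on the horizon `{n | n ≤ M}` dominates the geometric sequence through
its first two values there: `f 0 * (f 1 / f 0) ^ n ≤ f n` for `n ≤ M`, and its successive ratios increase. -/
theorem geom_mul_pow_le_of_logConvex (f : ℕ → ℝ) (M : ℕ) (hpos : ∀ n, n ≤ M → 0 < f n)
    (hconv : ∀ n, n + 2 ≤ M → f (n + 1) ^ 2 ≤ f n * f (n + 2)) :
    ∀ n, n ≤ M → f 0 * (f 1 / f 0) ^ n ≤ f n := by
  have key : ∀ n, n + 1 ≤ M →
      f 0 * (f 1 / f 0) ^ (n + 1) ≤ f (n + 1) ∧ f 1 / f 0 ≤ f (n + 1) / f n := by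
    intro n
    induction n with
    | zero =>
      intro h
      have h0 : 0 < f 0 := hpos 0 (by omega)
      refine ⟨?_, le_rfl⟩
      rw [pow_one, mul_div_cancel₀ _ h0.ne']
    | succ k ih =>
      intro h
      obtain ⟨h1, h2⟩ := ih (by omega)
      have hk : 0 < f k := hpos k (by omega)
      have hk1 : 0 < f (k + 1) := hpos (k + 1) (by omega)
      have hk2 : 0 < f (k + 2) := hpos (k + 2) (by omega)
      have hc := hconv k (by omega)
      have r : f (k + 1) / f k ≤ f (k + 2) / f (k + 1) := by
        rw [div_le_div_iff₀ hk hk1]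
        nlinarith [hc]
      have h02 : 0 ≤ f 1 / f 0 := div_nonneg (hpos 1 (by omega)).le (hpos 0 (by omega)).le
      refine ⟨?_, h2.trans r⟩
      calc f 0 * (f 1 / f 0) ^ (k + 1 + 1)
          = (f 0 * (f 1 / f 0) ^ (k + 1)) * (f 1 / f 0) := by ring
        _ ≤ f (k + 1) * (f (k + 2) / f (k + 1)) :=
            mul_le_mul h1 (h2.trans r) h02 hk1.le
        _ = f (k + 2) := by rw [mul_div_cancel₀ _ hk1.ne']
  intro n hn
  cases n with
  | zero => simp
  | succ k => exact (key k hn).1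

/-- The quantitative form used below: positivity and log-convexity on the horizon, a floor `v ≤ f 0` and a first
ratio `(1 - δ) * f 0 ≤ f 1` with `0 ≤ 1 - δ` give `v * (1 - δ) ^ n ≤ f n` on the horizon (any real `v`). -/
theorem floor_mul_pow_le_of_logConvex (f : ℕ → ℝ) (M : ℕ) (hpos : ∀ n, n ≤ M → 0 < f n)
    (hconv : ∀ n, n + 2 ≤ M → f (n + 1) ^ 2 ≤ f n * f (n + 2)) {v δ : ℝ}
    (hδ : 0 ≤ 1 - δ) (hfloor : v ≤ f 0) (hratio : (1 - δ) * f 0 ≤ f 1) (hM : 1 ≤ M) :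
    ∀ n, n ≤ M → v * (1 - δ) ^ n ≤ f n := by
  intro n hn
  have h0 : 0 < f 0 := hpos 0 (by omega)
  have hq : 1 - δ ≤ f 1 / f 0 := by
    rw [le_div_iff₀ h0]; exact hratio
  calc v * (1 - δ) ^ n ≤ f 0 * (f 1 / f 0) ^ n :=
        mul_le_mul hfloor (pow_le_pow_left₀ hδ hq n) (pow_nonneg hδ n) h0.le
    _ ≤ f n := geom_mul_pow_le_of_logConvex f M hpos hconv n hn

/-! ### The node and the witness -/

/-- **Lattice non-freezing** (Chatterjee 2019, Problem 5.1, second half, in volume-uniform form). For every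
compact simple `G` and faithful unitary lattice representation `r`, every constant `C` and rate `μ > 0`: for all
large `β`, on EVERY large periodic torus of side `2S + 1`, some plaquette pair — `P = r.curvature` at the origin
and its translate by `n ≤ S` lattice units in time and `y` (`y 0 = 0`) in space — has truncated correlation
`|⟨P ; τ_{(n,y)} P⟩_{β,S}| > C e^{−μ n}` under Wilson's measure at coupling `β`. Equivalently: no
`(C, μ > 0)` clusters the plaquette field at all large `β` on all large tori — the lattice correlation length of
`tr F²` diverges as `β → +∞`. Holds for `U(1)₄` (Coulomb phase); open in print for every non-abelian compact Lie
group in `d = 4`. [conjecture; sources: arXiv:1803.01950 §5 Problem 5.1; Montvay–Münster 1994 §3.7.1] -/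
@[conjecture] def LatticeNonFreezing : Prop :=
  ∀ (G : Type) [Group G] [TopologicalSpace G] [IsTopologicalGroup G] [CompactSpace G],
    IsCompactSimpleLieGroup G →
      letI : MeasurableSpace G := borel G
      haveI : BorelSpace G := ⟨rfl⟩
      ∀ (r : LatticeRep G) (C μ : ℝ), 0 < μ →
        ∃ β₀ : ℝ, ∀ β : ℝ, β₀ ≤ β → ∃ S₀ : ℕ, ∀ S : ℕ, S₀ ≤ S →
          ∃ (n : ℕ) (y : Site 4), n ≤ S ∧ y 0 = 0 ∧
            C * Real.exp (-(μ * n)) <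
              |latticeConnectedCorr r.ρ β (2 * S + 1) r.curvature.F
                (fun U => r.curvature.F (configShift (-y) U)) n|

/-- **Reflection-positivity variational witness** for non-freezing (the analytic deliverable of the seat's
architecture, stated as a closed proposition). Per compact simple `G` and representation `r`: for every `δ > 0`
there is `β₀` such that for every `β ≥ β₀` there are a floor `v > 0`, a constant `K` and a width `w` (all allowed
to depend on `β`) and a torus threshold `S₁` such that on every torus `S ≥ S₁` some real sequence `f` is
(a) positive and (b) log-convex on the horizon `n + w ≤ S` — intended `f(n) = ⟨θF_β · τ_{n e₀} F_β⟩_{β,S}`,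
positivity of the transfer matrix of Wilson's action (reflection positivity, Osterwalder–Seiler 1978);
(c) `(1 − δ) f(0) ≤ f(1)` — the one-step variational (Rayleigh-quotient) estimate, the hard input;
(d) `v ≤ f(0)` — strict positivity of the trial state's norm; (e) dominated by `K ·` every antitone envelope `b`
of the plaquette-pair truncated correlations on the torus (`|⟨P ; τ_{(m,y)} P⟩| ≤ b m` for all `m ≤ S`, `y`
spatial ⟹ `f(n) ≤ K b(n)` on the horizon) — automatic for `F_β` a finite combination, of `ℓ¹`-mass `‖h‖₁`, of
translates of `P` supported at time-distance `≤ w` (`K = ‖h‖₁²`). [conjecture: the seat's analytic target;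
see the seat's PLAN.md §4 P5 for the architecture (i)–(vii) intended to prove it] -/
@[conjecture] def RPVariationalWitness : Prop :=
  ∀ (G : Type) [Group G] [TopologicalSpace G] [IsTopologicalGroup G] [CompactSpace G],
    IsCompactSimpleLieGroup G →
      letI : MeasurableSpace G := borel G
      haveI : BorelSpace G := ⟨rfl⟩
      ∀ (r : LatticeRep G) (δ : ℝ), 0 < δ →
        ∃ β₀ : ℝ, ∀ β : ℝ, β₀ ≤ β →
          ∃ (v K : ℝ) (w S₁ : ℕ), 0 < v ∧ ∀ S : ℕ, S₁ ≤ S →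
            ∃ f : ℕ → ℝ,
              (∀ n : ℕ, n + w ≤ S → 0 < f n) ∧
              (∀ n : ℕ, n + 2 + w ≤ S → f (n + 1) ^ 2 ≤ f n * f (n + 2)) ∧
              (1 - δ) * f 0 ≤ f 1 ∧ v ≤ f 0 ∧
              ∀ b : ℕ → ℝ, Antitone b →
                (∀ m : ℕ, m ≤ S → ∀ y : Site 4, y 0 = 0 →
                  |latticeConnectedCorr r.ρ β (2 * S + 1) r.curvature.F
                      (fun U => r.curvature.F (configShift (-y) U)) m| ≤ b m) →
                ∀ n : ℕ, n + w ≤ S → f n ≤ K * b n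

/-! ### The criterion -/

/-- **Non-freezing criterion.** A reflection-positivity variational witness forces lattice non-freezing: with
`δ := 1 − e^{−μ/2}` the witness gives `f(n) ≥ v e^{−μ n/2}` on the horizon (log-convexity), while a uniform
bound `|⟨P ; τ P⟩| ≤ C e^{−μ m}` on the torus would give `f(n) ≤ K C e^{−μ n}`; the two are incompatible at
`n ≍ (2/μ) log (K C / v)`, which fits in every torus `S ≥ S₀(β)`. -/
theorem latticeNonFreezing_of_rpVariationalWitness (hW : RPVariationalWitness) : LatticeNonFreezing := by
  intro G _ _ _ _ hG
  -- keep the Borel structure chosen by the statement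
  letI : MeasurableSpace G := borel G
  haveI : BorelSpace G := ⟨rfl⟩
  intro r C μ hμ
  -- the witness at `δ := 1 - exp (-μ/2)`
  set δ : ℝ := 1 - Real.exp (-(μ / 2)) with hδdef
  have hδpos : 0 < δ := by
    have : Real.exp (-(μ / 2)) < 1 := Real.exp_lt_one_iff.mpr (by linarith)
    linarith
  have h1δ : 1 - δ = Real.exp (-(μ / 2)) := by rw [hδdef]; ring
  have h1δnn : 0 ≤ 1 - δ := by rw [h1δ]; exact (Real.exp_pos _).le
  obtain ⟨β₀, hβ₀⟩ := hW G hG r δ hδpos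
  refine ⟨β₀, fun β hβ => ?_⟩
  obtain ⟨v, K, w, S₁, hv, hS⟩ := hβ₀ β hβ
  -- negative `C`: the conclusion is trivial at `n = 0`, `y = 0`
  rcases lt_or_ge C 0 with hC | hC
  · refine ⟨S₁, fun S _ => ⟨0, 0, Nat.zero_le _, rfl, ?_⟩⟩
    have : C * Real.exp (-(μ * ((0 : ℕ) : ℝ))) < 0 := by
      rw [Nat.cast_zero, mul_zero, neg_zero, Real.exp_zero, mul_one]; exact hC
    exact this.trans_le (abs_nonneg _)
  -- growth: `v * exp (μ/2)^n → ∞`, pick `N` with `K * C < v * exp (μ/2) ^ N`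
  have hgt : 1 < Real.exp (μ / 2) := Real.one_lt_exp_iff.mpr (by linarith)
  have htend : Tendsto (fun n : ℕ => v * Real.exp (μ / 2) ^ n) atTop atTop :=
    Tendsto.const_mul_atTop hv (tendsto_pow_atTop_atTop_of_one_lt hgt)
  obtain ⟨N, hN⟩ := (htend.eventually_gt_atTop (K * C)).exists_forall_of_atTop
  have hNC : K * C < v * Real.exp (μ / 2) ^ N := hN N le_rfl
  refine ⟨max S₁ (N + w + 1), fun S hSS => ?_⟩
  have hS₁ : S₁ ≤ S := le_trans (le_max_left _ _) hSS
  have hNw : N + w + 1 ≤ S := le_trans (le_max_right _ _) hSS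
  obtain ⟨f, hfpos, hfconv, hratio, hfloor, hdom⟩ := hS S hS₁
  -- suppose every plaquette pair on this torus obeys the `C e^{-μ m}` bound
  by_contra hcon
  push Not at hcon
  have hbound : ∀ m : ℕ, m ≤ S → ∀ y : Site 4, y 0 = 0 →
      |latticeConnectedCorr r.ρ β (2 * S + 1) r.curvature.F
          (fun U => r.curvature.F (configShift (-y) U)) m| ≤ C * Real.exp (-(μ * m)) :=
    fun m hm y hy => hcon m y hm hy
  -- the envelope `b m := C e^{-μ m}` is antitone since `C ≥ 0`, `μ > 0`
  have hanti : Antitone (fun m : ℕ => C * Real.exp (-(μ * m))) := by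
    intro a b hab
    dsimp only
    refine mul_le_mul_of_nonneg_left ?_ hC
    refine Real.exp_le_exp.mpr ?_
    have : (a : ℝ) ≤ b := by exact_mod_cast hab
    nlinarith
  -- upper bound on the horizon point `N`
  have hup : f N ≤ K * (C * Real.exp (-(μ * N))) := hdom _ hanti hbound N (by omega)
  -- lower bound from log-convexity with `M := N + 1`
  have hlow : v * (1 - δ) ^ N ≤ f N :=
    floor_mul_pow_le_of_logConvex f (N + 1) (fun n hn => hfpos n (by omega))
      (fun n hn => hfconv n (by omega)) h1δnn hfloor hratio (by omega) N (by omega)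
  -- combine: `v * exp(-μ/2)^N ≤ K * C * exp(-μ N)`, i.e. `v * exp(μ/2)^N ≤ K * C`
  rw [h1δ] at hlow
  have hexpN : Real.exp (-(μ * N)) = (Real.exp (-(μ / 2)) ^ N) * (Real.exp (-(μ / 2)) ^ N) := by
    rw [← mul_pow, ← Real.exp_add, ← Real.exp_nat_mul]; congr 1; ring
  have hpowpos : 0 < Real.exp (-(μ / 2)) ^ N := pow_pos (Real.exp_pos _) N
  have hchain : v * Real.exp (-(μ / 2)) ^ N ≤ K * C * (Real.exp (-(μ / 2)) ^ N * Real.exp (-(μ / 2)) ^ N) := by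
    calc v * Real.exp (-(μ / 2)) ^ N ≤ f N := hlow
      _ ≤ K * (C * Real.exp (-(μ * N))) := hup
      _ = K * C * (Real.exp (-(μ / 2)) ^ N * Real.exp (-(μ / 2)) ^ N) := by rw [hexpN]; ring
  -- divide by `exp(-μ/2)^N > 0` and multiply through by `exp(μ/2)^N`
  have hdiv : v ≤ K * C * Real.exp (-(μ / 2)) ^ N := by
    have := div_le_div_of_nonneg_right hchain hpowpos.le
    rwa [mul_div_assoc, div_self hpowpos.ne', mul_one, mul_div_assoc,
      mul_div_assoc (Real.exp (-(μ / 2)) ^ N), div_self hpowpos.ne', mul_one] at this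
  have hinv : Real.exp (-(μ / 2)) ^ N * Real.exp (μ / 2) ^ N = 1 := by
    rw [← mul_pow, ← Real.exp_add, neg_add_cancel, Real.exp_zero, one_pow]
  have hfin : v * Real.exp (μ / 2) ^ N ≤ K * C := by
    have hq : 0 ≤ Real.exp (μ / 2) ^ N := pow_nonneg (Real.exp_pos _).le N
    calc v * Real.exp (μ / 2) ^ N ≤ (K * C * Real.exp (-(μ / 2)) ^ N) * Real.exp (μ / 2) ^ N :=
          mul_le_mul_of_nonneg_right hdiv hq
      _ = K * C := by rw [mul_assoc, hinv, mul_one]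
  exact absurd hNC (not_lt.mpr hfin)

/-- The criterion as a closed proposition (proved): `RPVariationalWitness → LatticeNonFreezing`. -/
def NonFreezingCriterion : Prop := RPVariationalWitness → LatticeNonFreezing

/-- `NonFreezingCriterion` holds. -/
theorem NonFreezingCriterion_holds : NonFreezingCriterion := latticeNonFreezing_of_rpVariationalWitness

end Summit.QuantumFields.YangMills.Theorems

end
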